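import Summits.HubbardSuperconductivity.HubbardSuperconductivity.Theses.VestigialChirality
import Summits.HubbardSuperconductivity.HubbardSuperconductivity.Theorems.ChiralWindowCwSsbToEvenTorusLROResidueMap

/-!
# Birth skeleton (BC3) for the split piece `SsbToEvenTorusLRO` (stmt-HubbardSuperconductivity-10439, SHARED)
# of `VestigialChirality.Target` — INHERITED line `griffiths-block-slope` v4.2 (crux-strategist cstrat-stmt-2416, 2026-08-17)

`VestigialChirality.SsbToEvenTorusLRO` is the shared item stmt-10439, word for word
`ChiralWindow.CwSsbToEvenTorusLRO` (and `Iff.rfl` the twin `WeakCouplingBCS.WcbcsSsbToTorusLRO`, stmt-2009).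
Its crux chain (`Cruxes/CwSsbToEvenTorusLRO/`, live lead) registered the skeleton `Lines/griffiths_block_slope.lean`
v4.2 with exactly two open stubs — the THERMODYNAMIC residue S2' (source-free grand-canonical block-slope floor)
and the INFRARED residue S7 (guarded weak-coupling leak of the d-wave pair structure factor) — and the residue map
`Theorems/ChiralWindowCwSsbToEvenTorusLROResidueMap.lean` (LANDED, p106548) proves
`S2' → S7 → ChiralWindow.CwSsbToEvenTorusLRO`.  This file does NOT open a new line on the shared crux (the lead's
files are untouched); it only certifies, kernel-checked, that the SAME two registered stubs conclude the piece under
its `VestigialChirality` name (the two route decls unfold to the same proposition), so the split piece X₂ inherits a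
2-stub skeleton: `SsbToEvenTorusLRO_of : S2' → S7 → VestigialChirality.SsbToEvenTorusLRO`.
Stub statements below are VERBATIM the registered ones (v4.2).  Sources: KomaTasaki1994 §2.5; Tasaki2019Tower §3.2;
KLS1988PRL; LiebSeiringerYngvason2007 (Griffiths lemma); Cruxes/CwSsbToEvenTorusLRO/SPLIT-PACKAGE.md.
-/

noncomputable section

set_option linter.dupNamespace false

namespace Summit.HubbardSuperconductivity.HubbardSuperconductivity.Cruxes.SsbToEvenTorusLRO.InheritedGriffithsBlockSlope

open Literature.MathematicalPhysics.QuantumLattice Literature.Probability.LatticeModels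
open Summit.HubbardSuperconductivity.HubbardSuperconductivity.Theorems.CwSsbToEvenTorusLRO
  (cwSsbToEvenTorusLRO_of_slopeFloor_of_infraredLeak)
open Filter Set Matrix
open scoped Matrix ComplexOrder BigOperators

/-- **S2' (thermodynamic residue; registered stub `stub_sourceFreeBlockSlopeFloor` of stmt-10439, verbatim).** -/
theorem stub_sourceFreeBlockSlopeFloor :
    ∃ U₀ : ℝ, 0 < U₀ ∧ ∀ U ∈ Set.Ioo (0:ℝ) U₀, ∀ δ ∈ Set.Ioo (0:ℝ) (1 / 2), ∀ μ : ℝ, Filter.Tendsto (fun L : ℕ => ((hubbardTorusWith 2 (L + 1) 1 U μ).groundStateFunctional totalNumber).re / ((L + 1 : ℕ) : ℝ) ^ 2) Filter.atTop (nhds (1 - δ)) → HasDWaveOrder U μ → ∃ a : ℝ, 0 < a ∧ ∀ R : ℕ, 0 < R → ∃ κ : ℝ, 0 < κ ∧ ∀ᶠ k : ℕ in Filter.atTop, κ * a * ((2 * k + 1 + 1 : ℕ) : ℝ) ^ 2 ≤ (hubbardTorusWith 2 (2 * k + 1 + 1) 1 U μ + (κ : ℂ) • (((((R : ℝ) ^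 4)⁻¹ : ℝ) : ℂ) • ∑ a : Literature.Probability.LatticeModels.TorusSite 2 (2 * k + 1 + 1), (∑ u : Fin 2 → Fin R, localPair dWaveFormFactor (2 * k + 1 + 1) (a + fun i => ((u i : ℕ) : ZMod (2 * k + 1 + 1))))ᴴ * (∑ u : Fin 2 → Fin R, localPair dWaveFormFactor (2 * k + 1 + 1) (a + fun i => ((u i : ℕ) : ZMod (2 * k + 1 + 1)))))).groundEnergy - (hubbardTorusWith 2 (2 * k + 1 + 1) 1 U μ).groundEnergy := by
  sorry

/-- **S7 (infrared residue; registered stub `stub_infraredLeak` of stmt-10439, verbatim).** -/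
theorem stub_infraredLeak :
    ∃ U₀ : ℝ, 0 < U₀ ∧ ∀ U ∈ Set.Ioo (0:ℝ) U₀, ∀ δ ∈ Set.Ioo (0:ℝ) (1 / 2), ∀ μ : ℝ, Filter.Tendsto (fun L : ℕ => ((hubbardTorusWith 2 (L + 1) 1 U μ).groundStateFunctional totalNumber).re / ((L + 1 : ℕ) : ℝ) ^ 2) Filter.atTop (nhds (1 - δ)) → HasDWaveOrder U μ → ∀ b : ℝ, 0 < b → ∃ η : ℝ, 0 < η ∧ ∀ᶠ k : ℕ in Filter.atTop, ∀ ψ : Fock (Orb (FermionTorus 2 (2 * k + 1 + 1))), IsGroundStateInSector (hubbardTorus 2 (2 * k + 1 + 1) 1 U) (2 * ⌊(1 - δ) * ((2 * k + 1 + 1 : ℕ) : ℝ) ^ 2 / 2⌋₊) 0 ψ → star ψ ⬝ᵥ ψ = 1 → (∑ m ∈ (Finset.univ.filter fun m : Literature.Probability.LatticeModels.TorusSite 2 (2 * k + 1 + 1) => m ≠ 0 ∧ momentumNormSq (2 * k + 1 + 1) m < η ^ 2), pairStructureFactor dWaveFormFactor (2 * k + 1 + 1) ψ m) / ((2 * k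 + 1 + 1 : ℕ) : ℝ) ^ 2 ≤ b := by
  sorry

/-- **Composition (kernel-checked): the inherited skeleton concludes the piece under its `VestigialChirality` name.**
`S2' → S7 → VestigialChirality.SsbToEvenTorusLRO`, through the landed residue map for `ChiralWindow.CwSsbToEvenTorusLRO`
(the two decls are definitionally the same proposition). -/
theorem SsbToEvenTorusLRO_of
    (h₁ : ∃ U₀ : ℝ, 0 < U₀ ∧ ∀ U ∈ Set.Ioo (0:ℝ) U₀, ∀ δ ∈ Set.Ioo (0:ℝ) (1 / 2), ∀ μ : ℝ, Filter.Tendsto (fun L : ℕ => ((hubbardTorusWith 2 (L + 1) 1 U μ).groundStateFunctional totalNumber).re / ((L + 1 : ℕ) : ℝ) ^ 2) Filter.atTop (nhds (1 - δ)) → HasDWaveOrder U μ → ∃ a : ℝ, 0 < a ∧ ∀ R : ℕ, 0 < R → ∃ κ : ℝ, 0 < κ ∧ ∀ᶠ k : ℕ in Filter.atTop, κ * a * ((2 * k + 1 + 1 : ℕ) : ℝ) ^ 2 ≤ (hubbardTorusWith 2 (2 * k + 1 + 1) 1 U μ + (κ : ℂ) • (((((R : ℝ) ^ 4)⁻¹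 : ℝ) : ℂ) • ∑ a : Literature.Probability.LatticeModels.TorusSite 2 (2 * k + 1 + 1), (∑ u : Fin 2 → Fin R, localPair dWaveFormFactor (2 * k + 1 + 1) (a + fun i => ((u i : ℕ) : ZMod (2 * k + 1 + 1))))ᴴ * (∑ u : Fin 2 → Fin R, localPair dWaveFormFactor (2 * k + 1 + 1) (a + fun i => ((u i : ℕ) : ZMod (2 * k + 1 + 1)))))).groundEnergy - (hubbardTorusWith 2 (2 * k + 1 + 1) 1 U μ).groundEnergy)
    (h₂ : ∃ U₀ : ℝ, 0 < U₀ ∧ ∀ U ∈ Set.Ioo (0:ℝ) U₀, ∀ δ ∈ Set.Ioo (0:ℝ) (1 / 2), ∀ μ : ℝ, Filter.Tendsto (fun L : ℕ => ((hubbardTorusWith 2 (L + 1) 1 U μ).groundStateFunctional totalNumber).re / ((L + 1 : ℕ) : ℝ) ^ 2) Filter.atTop (nhds (1 - δ)) → HasDWaveOrder U μ → ∀ b : ℝ, 0 < b → ∃ η : ℝ, 0 < η ∧ ∀ᶠ k : ℕ in Filter.atTop, ∀ ψ : Fock (Orb (FermionTorus 2 (2 * k + 1 + 1))), IsGroundStateInSector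 (hubbardTorus 2 (2 * k + 1 + 1) 1 U) (2 * ⌊(1 - δ) * ((2 * k + 1 + 1 : ℕ) : ℝ) ^ 2 / 2⌋₊) 0 ψ → star ψ ⬝ᵥ ψ = 1 → (∑ m ∈ (Finset.univ.filter fun m : Literature.Probability.LatticeModels.TorusSite 2 (2 * k + 1 + 1) => m ≠ 0 ∧ momentumNormSq (2 * k + 1 + 1) m < η ^ 2), pairStructureFactor dWaveFormFactor (2 * k + 1 + 1) ψ m) / ((2 * k + 1 + 1 : ℕ) : ℝ) ^ 2 ≤ b) :
    Summit.HubbardSuperconductivity.HubbardSuperconductivity.Theses.VestigialChirality.SsbToEvenTorusLRO := by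
  have h : Summit.HubbardSuperconductivity.HubbardSuperconductivity.Theses.ChiralWindow.CwSsbToEvenTorusLRO :=
    cwSsbToEvenTorusLRO_of_slopeFloor_of_infraredLeak h₁ h₂
  exact h

/-- The two route names are one proposition (recorded for the audit). -/
theorem ssbToEvenTorusLRO_iff_cw :
    Summit.HubbardSuperconductivity.HubbardSuperconductivity.Theses.VestigialChirality.SsbToEvenTorusLRO ↔
    Summit.HubbardSuperconductivity.HubbardSuperconductivity.Theses.ChiralWindow.CwSsbToEvenTorusLRO :=
  Iff.rfl

end Summit.HubbardSuperconductivity.HubbardSuperconductivity.Cruxes.SsbToEvenTorusLRO.InheritedGriffithsBlockSlope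

end
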